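import Mathlib
import HarnessLib
import Summits.NavierStokesRegularity.NavierStokesRegularity.Theorems.UnthreadedDoorAntidynamoWallSteadyCore

/-!
# Route `UnthreadedDoor` / `ThreadingFlux`, crux `PoloidalLiouville` (stmt-NavierStokesRegularity-1222), antidynamo v2 skeleton
# (sha16 `4ebf5683127b`), WALL `stub_scalarLiouville`: SCREW-PERIODIC AND PRECESSING VORTICITY PATTERNS collapse to exactly co-moving flows

Support file (seat leafhand-ns-unthreadeddoor-2 g1, cell decomp-ns), `--supports stmt-NavierStokesRegularity-1222 --as helper`; theorems only.

The «precession-gap» idea of the crux (ns-idea-15) singles out vorticity patterns that PRECESS rigidly about the centre.  In the twin language of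
p816196: if the vorticity at time `s + τ` (`τ ≤ 0`) is the `R`-rotation about `x₀` of the vorticity at time `s`, for every `s < 0` —
`curl v(s + τ)(x₀ + R y) = det R • R (curl v(s)(x₀ + y))` (screw-periodicity; `R = 1` is `|τ|`-periodicity, a one-parameter family `R = Q_τ` for all
`τ ≤ 0` is rigid precession) — then `u(s, x) = R⁻¹ v(s + τ, x₀ + R(x − x₀))` is a member of the class (`CellFlux.isBoundedAncientMildSolution_frame`)
with the same vorticity as `v` (`curl_conj_rigidMotion`, `det R⁻¹ · det R = 1`): a TWIN.

* ★★★ `curl_eq_zero_or_comoving_of_curl_screw` — screw-periodic vorticity ⇒ EITHER `curl v ≡ 0` on `(−∞,0) × ℝ³` OR the VELOCITY ITSELF is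
  screw-periodic: `v(s + τ, x₀ + R y) = R (v(s, x₀ + y))` for all `s < 0`, `y` (twin dichotomy + twins differ by their drift).
* ★★★ `curl_eq_zero_or_corotating_of_curl_precessing` — rigidly precessing vorticity (`R = Q τ` for every `τ ≤ 0`, ANY family `Q`, no group law
  needed) ⇒ irrotational ∨ the velocity co-rotates exactly: `v(s + τ, x₀ + Q τ y) = Q τ (v(s, x₀ + y))` for all `τ ≤ 0`, `s < 0`, `y`; in particular
  the centre velocity co-rotates, `v(s + τ, x₀) = Q τ (v(s, x₀))` (`centre_corotates_of_curl_precessing`).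

MEANING FOR THE WALL (repair census): the precessing sector is EXACTLY the class of genuine rotating waves about `x₀` (flows co-moving with their
vorticity pattern), with no Galilean gauge left — the object the precession-gap card must kill.  HONEST LABEL: corollaries of p816196; nothing here
proves `stub_scalarLiouville`, `PoloidalLiouville` (1222), or bears on Navier–Stokes regularity; no summit statement is proved (crux 1222 is
INCOMPARABLE with the summit). [folklore]
[cite: KochNadirashviliSereginSverak2009, Thm 5.2 (arXiv:0709.3599 pp. 9–10)]
-/

noncomputable section

-- the summit and its single sub-problem share the name (CONVENTIONS §1)
set_option linter.dupNamespace false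

open scoped Topology InnerProductSpace RealInnerProductSpace ContDiff
open Filter Set Function Metric MeasureTheory
open Literature.Analysis.FluidPDE

namespace Summit.NavierStokesRegularity.NavierStokesRegularity.Theorems.PoloidalLiouville.Antidynamo

open Summit.NavierStokesRegularity.NavierStokesRegularity.Theorems.PoloidalLiouville
  (constantOfIrrotational)
open Summit.NavierStokesRegularity.FluidComputer.AngularLadder (det_symm_eq_det)

/-! ### ★★★ Screw-periodic vorticity -/

/-- ★★★ **SCREW-PERIODIC VORTICITY ⇒ IRROTATIONAL OR SCREW-PERIODIC VELOCITY.**  Let `v` be a bounded ancient mild solution (`ν = 1`, duality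
class) with measurable slices, jointly smooth on `(−∞,0) × ℝ³` and unthreaded about `x₀`; let `R` be a linear isometry and `τ ≤ 0`.  If for every
`s < 0` the vorticity at time `s + τ` is the `R`-rotation about `x₀` of the vorticity at time `s` (as a pseudovector),
`curl v(s + τ)(x₀ + R y) = det R • R (curl v(s)(x₀ + y))`, then EITHER `curl v ≡ 0` on `(−∞,0) × ℝ³` OR
`v(s + τ, x₀ + R y) = R (v(s, x₀ + y))` for all `s < 0`, `y`. [cite: KochNadirashviliSereginSverak2009, Thm 5.2 (arXiv:0709.3599 pp. 9–10)] -/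
theorem curl_eq_zero_or_comoving_of_curl_screw
    (v : ℝ → EuclideanSpace ℝ (Fin 3) → EuclideanSpace ℝ (Fin 3)) (x₀ : EuclideanSpace ℝ (Fin 3))
    (hB : Literature.Analysis.FluidPDE.IsBoundedAncientMildSolution 1 v)
    (hm : ∀ t < 0, AEStronglyMeasurable (v t) volume)
    (hsm : ContDiffOn ℝ (⊤ : ℕ∞) (Function.uncurry v) (Set.Iio 0 ×ˢ Set.univ))
    (hun : ∀ t < 0, ∀ x, ⟪x - x₀, curl (v t) x⟫ = 0)
    (R : EuclideanSpace ℝ (Fin 3) ≃ₗᵢ[ℝ] EuclideanSpace ℝ (Fin 3)) {τ : ℝ} (hτ : τ ≤ 0)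
    (hscrew : ∀ s < 0, ∀ y, curl (v (s + τ)) (x₀ + R y) =
      (R : EuclideanSpace ℝ (Fin 3) →L[ℝ] EuclideanSpace ℝ (Fin 3)).det • R (curl (v s) (x₀ + y))) :
    (∀ t < 0, ∀ x, curl (v t) x = 0) ∨ ∀ s < 0, ∀ y, v (s + τ) (x₀ + R y) = R (v s (x₀ + y)) := by
  have hsm' : IsSmoothSpaceTimeOn (Iio 0) v := hsm
  -- the twin `u(s, x) = R⁻¹ v(s + τ, x₀ + R (x − x₀)) = R⁻¹ v(s + τ, R x + c)`
  set c : EuclideanSpace ℝ (Fin 3) := x₀ - R x₀ with hc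
  set u : ℝ → EuclideanSpace ℝ (Fin 3) → EuclideanSpace ℝ (Fin 3) := fun s y => R.symm (v (s + τ) (R y + c)) with hu
  have hBu : Literature.Analysis.FluidPDE.IsBoundedAncientMildSolution 1 u := by
    have h := CellFlux.isBoundedAncientMildSolution_frame hB R.symm c hτ
    have e : (fun s y => R.symm (v (s + τ) (R.symm.symm y + c))) = u := by
      funext s y
      rw [LinearIsometryEquiv.symm_symm]
    rw [e] at h
    exact h
  have hus : ∀ s < 0, ContDiff ℝ ∞ (u s) := fun s hs =>
    R.symm.contDiff.comp ((hsm'.contDiff_slice (show s + τ < 0 by linarith)).comp (R.contDiff.add contDiff_const))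
  have hmu : ∀ s < 0, AEStronglyMeasurable (u s) volume := fun s hs => (hus s hs).continuous.aestronglyMeasurable
  have hsmu : ContDiffOn ℝ (⊤ : ℕ∞) (Function.uncurry u) (Set.Iio 0 ×ˢ Set.univ) := by
    have hmap : ContDiff ℝ (⊤ : ℕ∞) fun p : ℝ × EuclideanSpace ℝ (Fin 3) => (p.1 + τ, R p.2 + c) :=
      (contDiff_fst.add contDiff_const).prodMk ((R.contDiff.comp contDiff_snd).add contDiff_const)
    have hmaps : MapsTo (fun p : ℝ × EuclideanSpace ℝ (Fin 3) => (p.1 + τ, R p.2 + c)) (Iio 0 ×ˢ univ) (Iio 0 ×ˢ univ) :=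
      fun p hp => ⟨by have h1 : p.1 < 0 := hp.1; show p.1 + τ < 0; linarith, mem_univ _⟩
    exact R.symm.contDiff.comp_contDiffOn (hsm.comp hmap.contDiffOn hmaps)
  -- the same vorticity
  have hcu : ∀ s < 0, ∀ x, curl (u s) x = curl (v s) x := by
    intro s hs x
    have h1 : curl (u s) x = (R.symm : EuclideanSpace ℝ (Fin 3) →L[ℝ] EuclideanSpace ℝ (Fin 3)).det •
        R.symm (curl (v (s + τ)) (R.symm.symm x + c)) := by
      rw [hu]
      exact curl_conj_rigidMotion R.symm c (v (s + τ)) x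
    have e1 : R.symm.symm x + c = x₀ + R (x - x₀) := by
      rw [LinearIsometryEquiv.symm_symm, hc, map_sub]
      abel
    rw [h1, e1, hscrew s hs (x - x₀), add_sub_cancel, map_smul, LinearIsometryEquiv.symm_apply_apply, smul_smul,
      det_symm_eq_det, det_linearIsometryEquiv_mul_self, one_smul]
  have hux0 : ∀ s, u s x₀ = R.symm (v (s + τ) x₀) := by
    intro s
    simp only [hu, hc, add_sub_cancel]
  rcases curl_eq_zero_or_twinDrift_eq_zero x₀ hB hm hsm hun hBu hmu hsmu hcu with h | hfix
  · exact Or.inl h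
  · right
    intro s hs y
    have h1 := twin_eq_add_drift x₀ hB hsm hBu hsmu hcu s hs (x₀ + y)
    rw [hfix s hs, sub_self, add_zero] at h1
    -- `u s (x₀ + y) = R⁻¹ (v (s + τ) (x₀ + R y))`
    have h2 : u s (x₀ + y) = R.symm (v (s + τ) (x₀ + R y)) := by
      simp only [hu, hc, map_add]
      congr 2
      abel
    rw [h2] at h1
    have h3 := congrArg R h1
    rwa [LinearIsometryEquiv.apply_symm_apply] at h3

/-- ★★★ **… HENCE: SLICE-WISE CONSTANT OR SCREW-PERIODIC VELOCITY.** [cite: KochNadirashviliSereginSverak2009, Thm 5.2 (arXiv:0709.3599 pp. 9–10)] -/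
theorem constant_or_comoving_of_curl_screw
    (v : ℝ → EuclideanSpace ℝ (Fin 3) → EuclideanSpace ℝ (Fin 3)) (x₀ : EuclideanSpace ℝ (Fin 3))
    (hB : Literature.Analysis.FluidPDE.IsBoundedAncientMildSolution 1 v)
    (hm : ∀ t < 0, AEStronglyMeasurable (v t) volume)
    (hsm : ContDiffOn ℝ (⊤ : ℕ∞) (Function.uncurry v) (Set.Iio 0 ×ˢ Set.univ))
    (hun : ∀ t < 0, ∀ x, ⟪x - x₀, curl (v t) x⟫ = 0)
    (R : EuclideanSpace ℝ (Fin 3) ≃ₗᵢ[ℝ] EuclideanSpace ℝ (Fin 3)) {τ : ℝ} (hτ : τ ≤ 0)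
    (hscrew : ∀ s < 0, ∀ y, curl (v (s + τ)) (x₀ + R y) =
      (R : EuclideanSpace ℝ (Fin 3) →L[ℝ] EuclideanSpace ℝ (Fin 3)).det • R (curl (v s) (x₀ + y))) :
    (∀ t < 0, ∃ b : EuclideanSpace ℝ (Fin 3), ∀ x, v t x = b) ∨ ∀ s < 0, ∀ y, v (s + τ) (x₀ + R y) = R (v s (x₀ + y)) := by
  rcases curl_eq_zero_or_comoving_of_curl_screw v x₀ hB hm hsm hun R hτ hscrew with h | h
  · exact Or.inl (constantOfIrrotational v hB hsm h)
  · exact Or.inr h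

/-! ### ★★★ Rigidly precessing vorticity -/

/-- ★★★ **RIGIDLY PRECESSING VORTICITY ⇒ IRROTATIONAL OR EXACTLY CO-ROTATING VELOCITY.**  Let `v` be as above and `Q : ℝ → (ℝ³ ≃ₗᵢ ℝ³)` ANY
family of linear isometries (no group law is needed) such that for every `τ ≤ 0` and `s < 0` the vorticity at time `s + τ` is the `Q τ`-rotation
about `x₀` of the vorticity at time `s`.  Then EITHER `curl v ≡ 0` on `(−∞,0) × ℝ³` OR `v(s + τ, x₀ + Q τ y) = Q τ (v(s, x₀ + y))` for all `τ ≤ 0`,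
`s < 0`, `y`: the flow is a genuine rotating wave about `x₀`. [cite: KochNadirashviliSereginSverak2009, Thm 5.2 (arXiv:0709.3599 pp. 9–10)] -/
theorem curl_eq_zero_or_corotating_of_curl_precessing
    (v : ℝ → EuclideanSpace ℝ (Fin 3) → EuclideanSpace ℝ (Fin 3)) (x₀ : EuclideanSpace ℝ (Fin 3))
    (hB : Literature.Analysis.FluidPDE.IsBoundedAncientMildSolution 1 v)
    (hm : ∀ t < 0, AEStronglyMeasurable (v t) volume)
    (hsm : ContDiffOn ℝ (⊤ : ℕ∞) (Function.uncurry v) (Set.Iio 0 ×ˢ Set.univ))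
    (hun : ∀ t < 0, ∀ x, ⟪x - x₀, curl (v t) x⟫ = 0)
    (Q : ℝ → (EuclideanSpace ℝ (Fin 3) ≃ₗᵢ[ℝ] EuclideanSpace ℝ (Fin 3)))
    (hprec : ∀ τ ≤ 0, ∀ s < 0, ∀ y, curl (v (s + τ)) (x₀ + Q τ y) =
      (Q τ : EuclideanSpace ℝ (Fin 3) →L[ℝ] EuclideanSpace ℝ (Fin 3)).det • Q τ (curl (v s) (x₀ + y))) :
    (∀ t < 0, ∀ x, curl (v t) x = 0) ∨
      ∀ τ ≤ 0, ∀ s < 0, ∀ y, v (s + τ) (x₀ + Q τ y) = Q τ (v s (x₀ + y)) := by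
  by_cases h0 : ∀ t < 0, ∀ x, curl (v t) x = 0
  · exact Or.inl h0
  · exact Or.inr fun τ hτ => (curl_eq_zero_or_comoving_of_curl_screw v x₀ hB hm hsm hun (Q τ) hτ (hprec τ hτ)).resolve_left h0

/-- ★★ **THE CENTRE VELOCITY OF A PRECESSING PATTERN CO-ROTATES**: under the hypotheses of `curl_eq_zero_or_corotating_of_curl_precessing`, either
`curl v ≡ 0` or `v(s + τ, x₀) = Q τ (v(s, x₀))` for all `τ ≤ 0`, `s < 0`. [cite: KochNadirashviliSereginSverak2009, Thm 5.2 (arXiv:0709.3599 pp. 9–10)] -/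
theorem curl_eq_zero_or_centre_corotates_of_curl_precessing
    (v : ℝ → EuclideanSpace ℝ (Fin 3) → EuclideanSpace ℝ (Fin 3)) (x₀ : EuclideanSpace ℝ (Fin 3))
    (hB : Literature.Analysis.FluidPDE.IsBoundedAncientMildSolution 1 v)
    (hm : ∀ t < 0, AEStronglyMeasurable (v t) volume)
    (hsm : ContDiffOn ℝ (⊤ : ℕ∞) (Function.uncurry v) (Set.Iio 0 ×ˢ Set.univ))
    (hun : ∀ t < 0, ∀ x, ⟪x - x₀, curl (v t) x⟫ = 0)
    (Q : ℝ → (EuclideanSpace ℝ (Fin 3) ≃ₗᵢ[ℝ] EuclideanSpace ℝ (Fin 3)))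
    (hprec : ∀ τ ≤ 0, ∀ s < 0, ∀ y, curl (v (s + τ)) (x₀ + Q τ y) =
      (Q τ : EuclideanSpace ℝ (Fin 3) →L[ℝ] EuclideanSpace ℝ (Fin 3)).det • Q τ (curl (v s) (x₀ + y))) :
    (∀ t < 0, ∀ x, curl (v t) x = 0) ∨ ∀ τ ≤ 0, ∀ s < 0, v (s + τ) x₀ = Q τ (v s x₀) := by
  rcases curl_eq_zero_or_corotating_of_curl_precessing v x₀ hB hm hsm hun Q hprec with h | h
  · exact Or.inl h
  · exact Or.inr fun τ hτ s hs => by simpa using h τ hτ s hs 0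

end Summit.NavierStokesRegularity.NavierStokesRegularity.Theorems.PoloidalLiouville.Antidynamo

end
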